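import Mathlib
import HarnessLib
import Summits.Ventures.LatticeQCDFlow.Exactness.SU2WilsonFlowLOSubstep
import Summits.Ventures.LatticeQCDFlow.Exactness.GaugeFTHMCReversible

/-!
# FT-HMC through the engine's `SU(2)` zero-parameter member is exact: the masked `SU(2)` Wilson-flow sub-step as a measurable equivalence of the gauge field, the quaternion exponential drift, Gaussian momenta

HONEST FRAMING: exact (Metropolis-corrected) sampling algorithms for lattice gauge theory;
figures of merit are autocorrelation/cost numbers at stated couplings and volumes; no
continuum-physics claim.

Venture `LatticeQCDFlow` (cell pub-lqcd), topic `Exactness`; FANOUT row 14 (`eng-flowhmc`, engine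
`latflow.fthmc`, family B; the row's acceptance configuration: FT-HMC through the LO Wilson-flow
map on 4⁴ `SU(2)`).  NEW WORK of the cell; nothing is cited as a fact; no number.  The `SU(2)`
twin of `U1WilsonFlowLOSubstep` / `U1FTHMCMembers`, closing the chain
`SU2KickJacobian → SU2KickPositiveJacobian → SU2WilsonFlowLOSubstep → ` (this file):

* `exists_measurableEquiv_of_bijective` — a measurable bijection of a standard Borel space is a
  measurable equivalence (Souslin); `polishSpace_SU2` — the tree's `SU(2)` is Polish.
* **`exists_measurableEquiv_su2WilsonFlowLOSubstep`** — the masked `SU(2)` Wilson-flow Euler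
  sub-step (`SU2WilsonFlowLOSubstep.su2WilsonFlowLOSubstep_certified`: measurable, bijective,
  certified Jacobian) IS a measurable equivalence `F` of `GaugeConfig d L SU(2)` with
  `HasJacobian (⊗_e haarProbability SU(2)) F (∏_active j̃)`, `j̃ > 0` measurable.
* The engine's link drift `U ← exp(c P) U`, `P ∈ su(2) ≅ ℝ³`, in quaternion coordinates
  `exp(c P) = gaussUnit (cos(c|P|), c sinc(c|P|) P)`: `gaussUnit_negIm`, **`su2Drift_neg`**
  (`e(−p) = e(p)⁻¹`, the one property of the exponential the argument uses), `measurable_su2Drift`.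
* **`su2_fthmc_leapfrog_gaussian_exact_wilsonFlowLOSubstep`** — FT-HMC EXACTLY AS THE ENGINE
  RUNS IT on the `SU(2)` rung — momenta `(Edge × Fin 3) → ℝ` with Lebesgue measure and
  `T = Σ p²/2`, refresh `N(0,1)`, leapfrog with the quaternion exponential drift and ANY
  measurable force, any `n`, flip, Metropolis on `(S ∘ F − log ∏ j̃) + T`, forget, report `F V` —
  through the masked `SU(2)` Wilson-flow sub-step leaves `e^{−S} · ⊗_e haarProbability SU(2)`
  invariant for every measurable action `S` (`GaugeFTHMCLeapfrog.gauge_fthmc_leapfrog_config_exact`);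
  **`su2_fthmc_leapfrog_gaussian_isReversible_wilsonFlowLOSubstep`** — and satisfies detailed
  balance (`GaugeFTHMCReversible.gauge_fthmc_leapfrog_config_isReversible`).

NOT here: schedules of sub-steps (compose by `NCPLayerEquiv.hasJacobian_foldr_trans` exactly as on
the U(1) rung); the typed identity of the kick with `exp(−εP(UR))U`; `SU(N ≥ 3)`; ergodicity.
-/

noncomputable section

namespace Summit.Ventures.LatticeQCDFlow.Exactness

open Real Set MeasureTheory Measure InnerProductGeometry Metric WithLp
open Literature.MathematicalPhysics.QuantumFieldTheory Summit.Ventures.LatticeQCDFlow.Theory2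
open ProbabilityTheory ProbabilityTheory.Kernel
open scoped ENNReal Matrix

/-! ## Measurable bijections of standard Borel spaces -/

section Souslin

/-- **A measurable bijection of a standard Borel space is a measurable equivalence** (Souslin:
a measurable injection from a standard Borel space is a measurable embedding, so images of
measurable sets are measurable). -/
theorem exists_measurableEquiv_of_bijective {α : Type*} [MeasurableSpace α] [StandardBorelSpace α]
    {f : α → α} (hf : Measurable f) (hb : Function.Bijective f) : ∃ e : α ≃ᵐ α, ⇑e = f := by
  have hemb : MeasurableEmbedding f := hf.measurableEmbedding hb.1
  have hsymm : Measurable (Equiv.ofBijective f hb).symm := fun s hs => by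
    rw [← Equiv.image_eq_preimage_symm]
    exact hemb.measurableSet_image.mpr hs
  exact ⟨⟨Equiv.ofBijective f hb, hf, hsymm⟩, rfl⟩

/-- The tree's `SU(2)` is a Polish space (a compact, hence closed, subset of `M₂(ℂ)`). -/
theorem polishSpace_SU2 : PolishSpace (Matrix.specialUnitaryGroup (Fin 2) ℂ) := by
  haveI : PolishSpace (Matrix (Fin 2) (Fin 2) ℂ) := inferInstanceAs (PolishSpace (Fin 2 → Fin 2 → ℂ))
  have hc : IsCompact ((Matrix.specialUnitaryGroup (Fin 2) ℂ : Set (Matrix (Fin 2) (Fin 2) ℂ))) :=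
    isCompact_iff_compactSpace.mpr (inferInstanceAs (CompactSpace (Matrix.specialUnitaryGroup (Fin 2) ℂ)))
  exact hc.isClosed.polishSpace

end Souslin

/-! ## The quaternion exponential drift -/

section Drift

variable {d L : ℕ} [NeZero L]

/-- Conjugating the imaginary coordinates conjugate-transposes the quaternion matrix. -/
theorem quatVec_negIm (y : R4) :
    quatVec (toLp 2 ![y 0, -y 1, -y 2, -y 3]) = (quatVec y)ᴴ := by
  ext i j
  fin_cases i <;> fin_cases j <;>
    simp [quatVec, quatOf, Matrix.conjTranspose_apply, Complex.ext_iff]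

/-- Conjugating the imaginary coordinates preserves the norm. -/
theorem norm_negIm (y : R4) : ‖toLp 2 ![y 0, -y 1, -y 2, -y 3]‖ = ‖y‖ := by
  have h : ‖toLp 2 ![y 0, -y 1, -y 2, -y 3]‖ ^ 2 = ‖y‖ ^ 2 := by
    rw [EuclideanSpace.real_norm_sq_eq, EuclideanSpace.real_norm_sq_eq, Fin.sum_univ_four,
      Fin.sum_univ_four]
    simp
  exact (pow_left_inj₀ (norm_nonneg _) (norm_nonneg _) two_ne_zero).1 h

/-- Conjugating the imaginary coordinates commutes with scaling. -/
theorem negIm_smul (c : ℝ) (y : R4) :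
    (toLp 2 ![(c • y) 0, -(c • y) 1, -(c • y) 2, -(c • y) 3] : R4) = c • toLp 2 ![y 0, -y 1, -y 2, -y 3] := by
  ext i
  fin_cases i <;> simp

/-- **Conjugate coordinates give the inverse**: `gaussUnit (y₀, −y⃗) = (gaussUnit y)⁻¹`. -/
theorem gaussUnit_negIm (y : R4) : gaussUnit (toLp 2 ![y 0, -y 1, -y 2, -y 3]) = (gaussUnit y)⁻¹ := by
  apply Subtype.ext
  rw [WilsonFlow.coe_inv_SU]
  rcases eq_or_ne y 0 with rfl | hy
  · have h0 : (toLp 2 ![(0 : R4) 0, -(0 : R4) 1, -(0 : R4) 2, -(0 : R4) 3] : R4) = 0 := by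
      ext i
      fin_cases i <;> simp
    rw [h0, gaussUnit_zero]
    simp
  · have hne : (toLp 2 ![y 0, -y 1, -y 2, -y 3] : R4) ≠ 0 := by
      intro h
      have h1 := norm_negIm y
      rw [h, norm_zero] at h1
      exact hy (norm_eq_zero.mp h1.symm)
    rw [coe_gaussUnit_of_ne_zero hne, coe_gaussUnit_of_ne_zero hy, norm_negIm, ← negIm_smul,
      quatVec_negIm]

omit [NeZero L] in
/-- **The quaternion exponential drift obeys the time-reversal law `e(−p) = e(p)⁻¹`** (the one
property of the exponential map the exactness argument uses): with `r = |P_ℓ|`,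
`exp(c P_ℓ) = gaussUnit (cos(c r), c sinc(c r) P_ℓ)` and `P ↦ −P` conjugates it. -/
theorem su2Drift_neg (c : ℝ) (p : (Edge d L × Fin 3) → ℝ) :
    (fun ℓ : Edge d L => gaussUnit (toLp 2
          ![Real.cos (c * Real.sqrt ((-p) (ℓ, 0) ^ 2 + (-p) (ℓ, 1) ^ 2 + (-p) (ℓ, 2) ^ 2)),
            c * Real.sinc (c * Real.sqrt ((-p) (ℓ, 0) ^ 2 + (-p) (ℓ, 1) ^ 2 + (-p) (ℓ, 2) ^ 2)) * (-p) (ℓ, 0),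
            c * Real.sinc (c * Real.sqrt ((-p) (ℓ, 0) ^ 2 + (-p) (ℓ, 1) ^ 2 + (-p) (ℓ, 2) ^ 2)) * (-p) (ℓ, 1),
            c * Real.sinc (c * Real.sqrt ((-p) (ℓ, 0) ^ 2 + (-p) (ℓ, 1) ^ 2 + (-p) (ℓ, 2) ^ 2)) * (-p) (ℓ, 2)])) =
      (fun ℓ : Edge d L => gaussUnit (toLp 2
          ![Real.cos (c * Real.sqrt (p (ℓ, 0) ^ 2 + p (ℓ, 1) ^ 2 + p (ℓ, 2) ^ 2)),
            c * Real.sinc (c * Real.sqrt (p (ℓ, 0) ^ 2 + p (ℓ, 1) ^ 2 + p (ℓ, 2) ^ 2)) * p (ℓ, 0),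
            c * Real.sinc (c * Real.sqrt (p (ℓ, 0) ^ 2 + p (ℓ, 1) ^ 2 + p (ℓ, 2) ^ 2)) * p (ℓ, 1),
            c * Real.sinc (c * Real.sqrt (p (ℓ, 0) ^ 2 + p (ℓ, 1) ^ 2 + p (ℓ, 2) ^ 2)) * p (ℓ, 2)]))⁻¹ := by
  funext ℓ
  simp only [Pi.inv_apply, Pi.neg_apply, neg_sq]
  rw [← gaussUnit_negIm]
  congr 1
  ext i
  fin_cases i <;> simp [mul_neg]

/-- The quaternion exponential drift is measurable in the momenta. -/
theorem measurable_su2Drift (c : ℝ) :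
    Measurable fun p : (Edge d L × Fin 3) → ℝ => fun ℓ : Edge d L => gaussUnit (toLp 2
          ![Real.cos (c * Real.sqrt (p (ℓ, 0) ^ 2 + p (ℓ, 1) ^ 2 + p (ℓ, 2) ^ 2)),
            c * Real.sinc (c * Real.sqrt (p (ℓ, 0) ^ 2 + p (ℓ, 1) ^ 2 + p (ℓ, 2) ^ 2)) * p (ℓ, 0),
            c * Real.sinc (c * Real.sqrt (p (ℓ, 0) ^ 2 + p (ℓ, 1) ^ 2 + p (ℓ, 2) ^ 2)) * p (ℓ, 1),
            c * Real.sinc (c * Real.sqrt (p (ℓ, 0) ^ 2 + p (ℓ, 1) ^ 2 + p (ℓ, 2) ^ 2)) * p (ℓ, 2)]) := by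
  refine measurable_pi_lambda _ fun ℓ => measurable_gaussUnit.comp ?_
  have hr : Continuous fun p : (Edge d L × Fin 3) → ℝ => Real.sqrt (p (ℓ, 0) ^ 2 + p (ℓ, 1) ^ 2 + p (ℓ, 2) ^ 2) := by
    fun_prop
  have hs : Continuous fun p : (Edge d L × Fin 3) → ℝ => c * Real.sinc (c * Real.sqrt (p (ℓ, 0) ^ 2 + p (ℓ, 1) ^ 2 + p (ℓ, 2) ^ 2)) :=
    continuous_const.mul (Real.continuous_sinc.comp (continuous_const.mul hr))
  refine ((PiLp.continuous_toLp 2 _).comp (continuous_pi fun i => ?_)).measurable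
  fin_cases i
  · show Continuous fun p : (Edge d L × Fin 3) → ℝ => Real.cos (c * Real.sqrt (p (ℓ, 0) ^ 2 + p (ℓ, 1) ^ 2 + p (ℓ, 2) ^ 2))
    exact Real.continuous_cos.comp (continuous_const.mul hr)
  · show Continuous fun p : (Edge d L × Fin 3) → ℝ => c * Real.sinc (c * Real.sqrt (p (ℓ, 0) ^ 2 + p (ℓ, 1) ^ 2 + p (ℓ, 2) ^ 2)) * p (ℓ, 0)
    exact hs.mul (continuous_apply _)
  · show Continuous fun p : (Edge d L × Fin 3) → ℝ => c * Real.sinc (c * Real.sqrt (p (ℓ, 0) ^ 2 + p (ℓ, 1) ^ 2 + p (ℓ, 2) ^ 2)) * p (ℓ, 1)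
    exact hs.mul (continuous_apply _)
  · show Continuous fun p : (Edge d L × Fin 3) → ℝ => c * Real.sinc (c * Real.sqrt (p (ℓ, 0) ^ 2 + p (ℓ, 1) ^ 2 + p (ℓ, 2) ^ 2)) * p (ℓ, 2)
    exact hs.mul (continuous_apply _)

end Drift

/-! ## The sub-step as a measurable equivalence; FT-HMC through it -/

section Member

variable {d L : ℕ} {X : Type*} [DecidableEq X] (χ : Site d L → X) [NeZero L]

/-- **The masked `SU(2)` Wilson-flow sub-step is a measurable equivalence of the gauge field with
certified Jacobian** (`su2WilsonFlowLOSubstep_certified` packaged via Souslin). -/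
theorem exists_measurableEquiv_su2WilsonFlowLOSubstep
    (hχ : ∀ (x : Site d L) (i : Fin d), χ (x.shift i) ≠ χ x) (μ : Fin d) (b : X) {ε : ℝ}
    (hε : |ε| * (2 * ((d - 1 : ℕ) : ℝ)) < 1) :
    ∃ F : GaugeConfig d L (Matrix.specialUnitaryGroup (Fin 2) ℂ) ≃ᵐ GaugeConfig d L (Matrix.specialUnitaryGroup (Fin 2) ℂ),
      (⇑F = fun (V : GaugeConfig d L (Matrix.specialUnitaryGroup (Fin 2) ℂ)) (e : Edge d L) =>
        if e.2 = μ ∧ χ e.1 = b then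
          gaussUnit (geodesicKick ε (∑ ν ∈ Finset.univ.erase e.2,
            (vecQuat (((V (Site.shift e.1 e.2, ν) * (V (Site.shift e.1 ν, e.2))⁻¹ * (V (e.1, ν))⁻¹)⁻¹ : (Matrix.specialUnitaryGroup (Fin 2) ℂ)) : Matrix (Fin 2) (Fin 2) ℂ) +
              vecQuat ((((V (Site.shift (e.1 - Pi.single ν 1) e.2, ν))⁻¹ * (V (e.1 - Pi.single ν 1, e.2))⁻¹ *
                V (e.1 - Pi.single ν 1, ν))⁻¹ : (Matrix.specialUnitaryGroup (Fin 2) ℂ)) : Matrix (Fin 2) (Fin 2) ℂ)))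
            (vecQuat ((V e : (Matrix.specialUnitaryGroup (Fin 2) ℂ)) : Matrix (Fin 2) (Fin 2) ℂ)))
        else V e) ∧
      HasJacobian (Measure.pi fun _ : Edge d L => haarProbability (Matrix.specialUnitaryGroup (Fin 2) ℂ)) F
        (fun V => ENNReal.ofReal (∏ a : {e : Edge d L // e.2 = μ ∧ χ e.1 = b},
          (if Real.sin (angle (∑ ν ∈ Finset.univ.erase a.1.2,
            (vecQuat (((V (Site.shift a.1.1 a.1.2, ν) * (V (Site.shift a.1.1 ν, a.1.2))⁻¹ * (V (a.1.1, ν))⁻¹)⁻¹ : (Matrix.specialUnitaryGroup (Fin 2) ℂ)) : Matrix (Fin 2) (Fin 2) ℂ) +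
              vecQuat ((((V (Site.shift (a.1.1 - Pi.single ν 1) a.1.2, ν))⁻¹ * (V (a.1.1 - Pi.single ν 1, a.1.2))⁻¹ *
                V (a.1.1 - Pi.single ν 1, ν))⁻¹ : (Matrix.specialUnitaryGroup (Fin 2) ℂ)) : Matrix (Fin 2) (Fin 2) ℂ))) (vecQuat ((V a.1 : (Matrix.specialUnitaryGroup (Fin 2) ℂ)) : Matrix (Fin 2) (Fin 2) ℂ))) = 0 then
            (1 - ε * ‖(∑ ν ∈ Finset.univ.erase a.1.2,
            (vecQuat (((V (Site.shift a.1.1 a.1.2, ν) * (V (Site.shift a.1.1 ν, a.1.2))⁻¹ * (V (a.1.1, ν))⁻¹)⁻¹ : (Matrix.specialUnitaryGroup (Fin 2) ℂ)) : Matrix (Fin 2) (Fin 2) ℂ) +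
              vecQuat ((((V (Site.shift (a.1.1 - Pi.single ν 1) a.1.2, ν))⁻¹ * (V (a.1.1 - Pi.single ν 1, a.1.2))⁻¹ *
                V (a.1.1 - Pi.single ν 1, ν))⁻¹ : (Matrix.specialUnitaryGroup (Fin 2) ℂ)) : Matrix (Fin 2) (Fin 2) ℂ)))‖ * Real.cos (angle (∑ ν ∈ Finset.univ.erase a.1.2,
            (vecQuat (((V (Site.shift a.1.1 a.1.2, ν) * (V (Site.shift a.1.1 ν, a.1.2))⁻¹ * (V (a.1.1, ν))⁻¹)⁻¹ : (Matrix.specialUnitaryGroup (Fin 2) ℂ)) : Matrix (Fin 2) (Fin 2) ℂ) +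
              vecQuat ((((V (Site.shift (a.1.1 - Pi.single ν 1) a.1.2, ν))⁻¹ * (V (a.1.1 - Pi.single ν 1, a.1.2))⁻¹ *
                V (a.1.1 - Pi.single ν 1, ν))⁻¹ : (Matrix.specialUnitaryGroup (Fin 2) ℂ)) : Matrix (Fin 2) (Fin 2) ℂ))) (vecQuat ((V a.1 : (Matrix.specialUnitaryGroup (Fin 2) ℂ)) : Matrix (Fin 2) (Fin 2) ℂ)))) ^ 3
          else kickJac (ε * ‖(∑ ν ∈ Finset.univ.erase a.1.2,
            (vecQuat (((V (Site.shift a.1.1 a.1.2, ν) * (V (Site.shift a.1.1 ν, a.1.2))⁻¹ * (V (a.1.1, ν))⁻¹)⁻¹ : (Matrix.specialUnitaryGroup (Fin 2) ℂ)) : Matrix (Fin 2) (Fin 2) ℂ) +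
              vecQuat ((((V (Site.shift (a.1.1 - Pi.single ν 1) a.1.2, ν))⁻¹ * (V (a.1.1 - Pi.single ν 1, a.1.2))⁻¹ *
                V (a.1.1 - Pi.single ν 1, ν))⁻¹ : (Matrix.specialUnitaryGroup (Fin 2) ℂ)) : Matrix (Fin 2) (Fin 2) ℂ)))‖) 2 (angle (∑ ν ∈ Finset.univ.erase a.1.2,
            (vecQuat (((V (Site.shift a.1.1 a.1.2, ν) * (V (Site.shift a.1.1 ν, a.1.2))⁻¹ * (V (a.1.1, ν))⁻¹)⁻¹ : (Matrix.specialUnitaryGroup (Fin 2) ℂ)) : Matrix (Fin 2) (Fin 2) ℂ) +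
              vecQuat ((((V (Site.shift (a.1.1 - Pi.single ν 1) a.1.2, ν))⁻¹ * (V (a.1.1 - Pi.single ν 1, a.1.2))⁻¹ *
                V (a.1.1 - Pi.single ν 1, ν))⁻¹ : (Matrix.specialUnitaryGroup (Fin 2) ℂ)) : Matrix (Fin 2) (Fin 2) ℂ))) (vecQuat ((V a.1 : (Matrix.specialUnitaryGroup (Fin 2) ℂ)) : Matrix (Fin 2) (Fin 2) ℂ)))))) ∧
      (∀ V : GaugeConfig d L (Matrix.specialUnitaryGroup (Fin 2) ℂ), 0 < ∏ a : {e : Edge d L // e.2 = μ ∧ χ e.1 = b},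
          (if Real.sin (angle (∑ ν ∈ Finset.univ.erase a.1.2,
            (vecQuat (((V (Site.shift a.1.1 a.1.2, ν) * (V (Site.shift a.1.1 ν, a.1.2))⁻¹ * (V (a.1.1, ν))⁻¹)⁻¹ : (Matrix.specialUnitaryGroup (Fin 2) ℂ)) : Matrix (Fin 2) (Fin 2) ℂ) +
              vecQuat ((((V (Site.shift (a.1.1 - Pi.single ν 1) a.1.2, ν))⁻¹ * (V (a.1.1 - Pi.single ν 1, a.1.2))⁻¹ *
                V (a.1.1 - Pi.single ν 1, ν))⁻¹ : (Matrix.specialUnitaryGroup (Fin 2) ℂ)) : Matrix (Fin 2) (Fin 2) ℂ))) (vecQuat ((V a.1 : (Matrix.specialUnitaryGroup (Fin 2) ℂ)) : Matrix (Fin 2) (Fin 2) ℂ))) = 0 then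
            (1 - ε * ‖(∑ ν ∈ Finset.univ.erase a.1.2,
            (vecQuat (((V (Site.shift a.1.1 a.1.2, ν) * (V (Site.shift a.1.1 ν, a.1.2))⁻¹ * (V (a.1.1, ν))⁻¹)⁻¹ : (Matrix.specialUnitaryGroup (Fin 2) ℂ)) : Matrix (Fin 2) (Fin 2) ℂ) +
              vecQuat ((((V (Site.shift (a.1.1 - Pi.single ν 1) a.1.2, ν))⁻¹ * (V (a.1.1 - Pi.single ν 1, a.1.2))⁻¹ *
                V (a.1.1 - Pi.single ν 1, ν))⁻¹ : (Matrix.specialUnitaryGroup (Fin 2) ℂ)) : Matrix (Fin 2) (Fin 2) ℂ)))‖ * Real.cos (angle (∑ ν ∈ Finset.univ.erase a.1.2,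
            (vecQuat (((V (Site.shift a.1.1 a.1.2, ν) * (V (Site.shift a.1.1 ν, a.1.2))⁻¹ * (V (a.1.1, ν))⁻¹)⁻¹ : (Matrix.specialUnitaryGroup (Fin 2) ℂ)) : Matrix (Fin 2) (Fin 2) ℂ) +
              vecQuat ((((V (Site.shift (a.1.1 - Pi.single ν 1) a.1.2, ν))⁻¹ * (V (a.1.1 - Pi.single ν 1, a.1.2))⁻¹ *
                V (a.1.1 - Pi.single ν 1, ν))⁻¹ : (Matrix.specialUnitaryGroup (Fin 2) ℂ)) : Matrix (Fin 2) (Fin 2) ℂ))) (vecQuat ((V a.1 : (Matrix.specialUnitaryGroup (Fin 2) ℂ)) : Matrix (Fin 2) (Fin 2) ℂ)))) ^ 3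
          else kickJac (ε * ‖(∑ ν ∈ Finset.univ.erase a.1.2,
            (vecQuat (((V (Site.shift a.1.1 a.1.2, ν) * (V (Site.shift a.1.1 ν, a.1.2))⁻¹ * (V (a.1.1, ν))⁻¹)⁻¹ : (Matrix.specialUnitaryGroup (Fin 2) ℂ)) : Matrix (Fin 2) (Fin 2) ℂ) +
              vecQuat ((((V (Site.shift (a.1.1 - Pi.single ν 1) a.1.2, ν))⁻¹ * (V (a.1.1 - Pi.single ν 1, a.1.2))⁻¹ *
                V (a.1.1 - Pi.single ν 1, ν))⁻¹ : (Matrix.specialUnitaryGroup (Fin 2) ℂ)) : Matrix (Fin 2) (Fin 2) ℂ)))‖) 2 (angle (∑ ν ∈ Finset.univ.erase a.1.2,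
            (vecQuat (((V (Site.shift a.1.1 a.1.2, ν) * (V (Site.shift a.1.1 ν, a.1.2))⁻¹ * (V (a.1.1, ν))⁻¹)⁻¹ : (Matrix.specialUnitaryGroup (Fin 2) ℂ)) : Matrix (Fin 2) (Fin 2) ℂ) +
              vecQuat ((((V (Site.shift (a.1.1 - Pi.single ν 1) a.1.2, ν))⁻¹ * (V (a.1.1 - Pi.single ν 1, a.1.2))⁻¹ *
                V (a.1.1 - Pi.single ν 1, ν))⁻¹ : (Matrix.specialUnitaryGroup (Fin 2) ℂ)) : Matrix (Fin 2) (Fin 2) ℂ))) (vecQuat ((V a.1 : (Matrix.specialUnitaryGroup (Fin 2) ℂ)) : Matrix (Fin 2) (Fin 2) ℂ))))) ∧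
      Measurable fun V : GaugeConfig d L (Matrix.specialUnitaryGroup (Fin 2) ℂ) => ∏ a : {e : Edge d L // e.2 = μ ∧ χ e.1 = b},
          (if Real.sin (angle (∑ ν ∈ Finset.univ.erase a.1.2,
            (vecQuat (((V (Site.shift a.1.1 a.1.2, ν) * (V (Site.shift a.1.1 ν, a.1.2))⁻¹ * (V (a.1.1, ν))⁻¹)⁻¹ : (Matrix.specialUnitaryGroup (Fin 2) ℂ)) : Matrix (Fin 2) (Fin 2) ℂ) +
              vecQuat ((((V (Site.shift (a.1.1 - Pi.single ν 1) a.1.2, ν))⁻¹ * (V (a.1.1 - Pi.single ν 1, a.1.2))⁻¹ *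
                V (a.1.1 - Pi.single ν 1, ν))⁻¹ : (Matrix.specialUnitaryGroup (Fin 2) ℂ)) : Matrix (Fin 2) (Fin 2) ℂ))) (vecQuat ((V a.1 : (Matrix.specialUnitaryGroup (Fin 2) ℂ)) : Matrix (Fin 2) (Fin 2) ℂ))) = 0 then
            (1 - ε * ‖(∑ ν ∈ Finset.univ.erase a.1.2,
            (vecQuat (((V (Site.shift a.1.1 a.1.2, ν) * (V (Site.shift a.1.1 ν, a.1.2))⁻¹ * (V (a.1.1, ν))⁻¹)⁻¹ : (Matrix.specialUnitaryGroup (Fin 2) ℂ)) : Matrix (Fin 2) (Fin 2) ℂ) +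
              vecQuat ((((V (Site.shift (a.1.1 - Pi.single ν 1) a.1.2, ν))⁻¹ * (V (a.1.1 - Pi.single ν 1, a.1.2))⁻¹ *
                V (a.1.1 - Pi.single ν 1, ν))⁻¹ : (Matrix.specialUnitaryGroup (Fin 2) ℂ)) : Matrix (Fin 2) (Fin 2) ℂ)))‖ * Real.cos (angle (∑ ν ∈ Finset.univ.erase a.1.2,
            (vecQuat (((V (Site.shift a.1.1 a.1.2, ν) * (V (Site.shift a.1.1 ν, a.1.2))⁻¹ * (V (a.1.1, ν))⁻¹)⁻¹ : (Matrix.specialUnitaryGroup (Fin 2) ℂ)) : Matrix (Fin 2) (Fin 2) ℂ) +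
              vecQuat ((((V (Site.shift (a.1.1 - Pi.single ν 1) a.1.2, ν))⁻¹ * (V (a.1.1 - Pi.single ν 1, a.1.2))⁻¹ *
                V (a.1.1 - Pi.single ν 1, ν))⁻¹ : (Matrix.specialUnitaryGroup (Fin 2) ℂ)) : Matrix (Fin 2) (Fin 2) ℂ))) (vecQuat ((V a.1 : (Matrix.specialUnitaryGroup (Fin 2) ℂ)) : Matrix (Fin 2) (Fin 2) ℂ)))) ^ 3
          else kickJac (ε * ‖(∑ ν ∈ Finset.univ.erase a.1.2,
            (vecQuat (((V (Site.shift a.1.1 a.1.2, ν) * (V (Site.shift a.1.1 ν, a.1.2))⁻¹ * (V (a.1.1, ν))⁻¹)⁻¹ : (Matrix.specialUnitaryGroup (Fin 2) ℂ)) : Matrix (Fin 2) (Fin 2) ℂ) +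
              vecQuat ((((V (Site.shift (a.1.1 - Pi.single ν 1) a.1.2, ν))⁻¹ * (V (a.1.1 - Pi.single ν 1, a.1.2))⁻¹ *
                V (a.1.1 - Pi.single ν 1, ν))⁻¹ : (Matrix.specialUnitaryGroup (Fin 2) ℂ)) : Matrix (Fin 2) (Fin 2) ℂ)))‖) 2 (angle (∑ ν ∈ Finset.univ.erase a.1.2,
            (vecQuat (((V (Site.shift a.1.1 a.1.2, ν) * (V (Site.shift a.1.1 ν, a.1.2))⁻¹ * (V (a.1.1, ν))⁻¹)⁻¹ : (Matrix.specialUnitaryGroup (Fin 2) ℂ)) : Matrix (Fin 2) (Fin 2) ℂ) +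
              vecQuat ((((V (Site.shift (a.1.1 - Pi.single ν 1) a.1.2, ν))⁻¹ * (V (a.1.1 - Pi.single ν 1, a.1.2))⁻¹ *
                V (a.1.1 - Pi.single ν 1, ν))⁻¹ : (Matrix.specialUnitaryGroup (Fin 2) ℂ)) : Matrix (Fin 2) (Fin 2) ℂ))) (vecQuat ((V a.1 : (Matrix.specialUnitaryGroup (Fin 2) ℂ)) : Matrix (Fin 2) (Fin 2) ℂ)))) := by
  haveI : PolishSpace (Matrix.specialUnitaryGroup (Fin 2) ℂ) := polishSpace_SU2
  obtain ⟨hmeas, hbij, hJ, hpos, hJm⟩ := su2WilsonFlowLOSubstep_certified χ hχ μ b hε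
  obtain ⟨F, hF⟩ := exists_measurableEquiv_of_bijective hmeas hbij
  refine ⟨F, hF, ?_, hpos, hJm⟩
  rw [hF]
  exact hJ

/-- **FT-HMC exactly as the engine runs it on the `SU(2)` rung, through the masked `SU(2)`
Wilson-flow sub-step, is exact.**  Momenta `(Edge × Fin 3) → ℝ` (three real components per link =
`su(2)`), Lebesgue reference, `T = Σ p²/2`, refresh `N(0, 1)`; leapfrog with the quaternion
exponential drift `U_ℓ ← exp(c P_ℓ) U_ℓ` and ANY measurable force `g`, any number of steps `n`,
flip, Metropolis on `(S ∘ F − log ∏ j̃) + T`, forget, report `F V`.  For every measurable action `S`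
the configuration kernel leaves `e^{−S} · ⊗_e haarProbability SU(2)` invariant. -/
theorem su2_fthmc_leapfrog_gaussian_exact_wilsonFlowLOSubstep
    (hχ : ∀ (x : Site d L) (i : Fin d), χ (x.shift i) ≠ χ x) (μ : Fin d) (b : X) {ε : ℝ}
    (hε : |ε| * (2 * ((d - 1 : ℕ) : ℝ)) < 1)
    {S : GaugeConfig d L (Matrix.specialUnitaryGroup (Fin 2) ℂ) → ℝ} (hS : Measurable S) (c : ℝ)
    {g : GaugeConfig d L (Matrix.specialUnitaryGroup (Fin 2) ℂ) → ((Edge d L × Fin 3) → ℝ)} (hg : Measurable g) (n : ℕ) :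
    ∃ F : GaugeConfig d L (Matrix.specialUnitaryGroup (Fin 2) ℂ) ≃ᵐ GaugeConfig d L (Matrix.specialUnitaryGroup (Fin 2) ℂ),
      (⇑F = fun (V : GaugeConfig d L (Matrix.specialUnitaryGroup (Fin 2) ℂ)) (e : Edge d L) =>
        if e.2 = μ ∧ χ e.1 = b then
          gaussUnit (geodesicKick ε (∑ ν ∈ Finset.univ.erase e.2,
            (vecQuat (((V (Site.shift e.1 e.2, ν) * (V (Site.shift e.1 ν, e.2))⁻¹ * (V (e.1, ν))⁻¹)⁻¹ : (Matrix.specialUnitaryGroup (Fin 2) ℂ)) : Matrix (Fin 2) (Fin 2) ℂ) +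
              vecQuat ((((V (Site.shift (e.1 - Pi.single ν 1) e.2, ν))⁻¹ * (V (e.1 - Pi.single ν 1, e.2))⁻¹ *
                V (e.1 - Pi.single ν 1, ν))⁻¹ : (Matrix.specialUnitaryGroup (Fin 2) ℂ)) : Matrix (Fin 2) (Fin 2) ℂ)))
            (vecQuat ((V e : (Matrix.specialUnitaryGroup (Fin 2) ℂ)) : Matrix (Fin 2) (Fin 2) ℂ)))
        else V e) ∧
      Invariant
        (conjKernel
          (refreshUpdate
            (involMH
              (⇑((flip : Equiv.Perm (GaugeConfig d L (Matrix.specialUnitaryGroup (Fin 2) ℂ) × ((Edge d L × Fin 3) → ℝ))) *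
                  leapfrog (mulDrift fun p : (Edge d L × Fin 3) → ℝ =>
                    fun ℓ : Edge d L => gaussUnit (toLp 2
          ![Real.cos (c * Real.sqrt (p (ℓ, 0) ^ 2 + p (ℓ, 1) ^ 2 + p (ℓ, 2) ^ 2)),
            c * Real.sinc (c * Real.sqrt (p (ℓ, 0) ^ 2 + p (ℓ, 1) ^ 2 + p (ℓ, 2) ^ 2)) * p (ℓ, 0),
            c * Real.sinc (c * Real.sqrt (p (ℓ, 0) ^ 2 + p (ℓ, 1) ^ 2 + p (ℓ, 2) ^ 2)) * p (ℓ, 1),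
            c * Real.sinc (c * Real.sqrt (p (ℓ, 0) ^ 2 + p (ℓ, 1) ^ 2 + p (ℓ, 2) ^ 2)) * p (ℓ, 2)])) g ^ n))
              (measurable_flip_leapfrog_pow (measurable_mulDrift (measurable_su2Drift c)) hg n)
              fun z : GaugeConfig d L (Matrix.specialUnitaryGroup (Fin 2) ℂ) × ((Edge d L × Fin 3) → ℝ) =>
                (S (F z.1) - Real.log (∏ a : {e : Edge d L // e.2 = μ ∧ χ e.1 = b},
          (if Real.sin (angle (∑ ν ∈ Finset.univ.erase a.1.2,
            (vecQuat (((z.1 (Site.shift a.1.1 a.1.2, ν) * (z.1 (Site.shift a.1.1 ν, a.1.2))⁻¹ * (z.1 (a.1.1, ν))⁻¹)⁻¹ : (Matrix.specialUnitaryGroup (Fin 2) ℂ)) : Matrix (Fin 2) (Fin 2) ℂ) +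
              vecQuat ((((z.1 (Site.shift (a.1.1 - Pi.single ν 1) a.1.2, ν))⁻¹ * (z.1 (a.1.1 - Pi.single ν 1, a.1.2))⁻¹ *
                z.1 (a.1.1 - Pi.single ν 1, ν))⁻¹ : (Matrix.specialUnitaryGroup (Fin 2) ℂ)) : Matrix (Fin 2) (Fin 2) ℂ))) (vecQuat ((z.1 a.1 : (Matrix.specialUnitaryGroup (Fin 2) ℂ)) : Matrix (Fin 2) (Fin 2) ℂ))) = 0 then
            (1 - ε * ‖(∑ ν ∈ Finset.univ.erase a.1.2,
            (vecQuat (((z.1 (Site.shift a.1.1 a.1.2, ν) * (z.1 (Site.shift a.1.1 ν, a.1.2))⁻¹ * (z.1 (a.1.1, ν))⁻¹)⁻¹ : (Matrix.specialUnitaryGroup (Fin 2) ℂ)) : Matrix (Fin 2) (Fin 2) ℂ) +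
              vecQuat ((((z.1 (Site.shift (a.1.1 - Pi.single ν 1) a.1.2, ν))⁻¹ * (z.1 (a.1.1 - Pi.single ν 1, a.1.2))⁻¹ *
                z.1 (a.1.1 - Pi.single ν 1, ν))⁻¹ : (Matrix.specialUnitaryGroup (Fin 2) ℂ)) : Matrix (Fin 2) (Fin 2) ℂ)))‖ * Real.cos (angle (∑ ν ∈ Finset.univ.erase a.1.2,
            (vecQuat (((z.1 (Site.shift a.1.1 a.1.2, ν) * (z.1 (Site.shift a.1.1 ν, a.1.2))⁻¹ * (z.1 (a.1.1, ν))⁻¹)⁻¹ : (Matrix.specialUnitaryGroup (Fin 2) ℂ)) : Matrix (Fin 2) (Fin 2) ℂ) +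
              vecQuat ((((z.1 (Site.shift (a.1.1 - Pi.single ν 1) a.1.2, ν))⁻¹ * (z.1 (a.1.1 - Pi.single ν 1, a.1.2))⁻¹ *
                z.1 (a.1.1 - Pi.single ν 1, ν))⁻¹ : (Matrix.specialUnitaryGroup (Fin 2) ℂ)) : Matrix (Fin 2) (Fin 2) ℂ))) (vecQuat ((z.1 a.1 : (Matrix.specialUnitaryGroup (Fin 2) ℂ)) : Matrix (Fin 2) (Fin 2) ℂ)))) ^ 3
          else kickJac (ε * ‖(∑ ν ∈ Finset.univ.erase a.1.2,
            (vecQuat (((z.1 (Site.shift a.1.1 a.1.2, ν) * (z.1 (Site.shift a.1.1 ν, a.1.2))⁻¹ * (z.1 (a.1.1, ν))⁻¹)⁻¹ : (Matrix.specialUnitaryGroup (Fin 2) ℂ)) : Matrix (Fin 2) (Fin 2) ℂ) +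
              vecQuat ((((z.1 (Site.shift (a.1.1 - Pi.single ν 1) a.1.2, ν))⁻¹ * (z.1 (a.1.1 - Pi.single ν 1, a.1.2))⁻¹ *
                z.1 (a.1.1 - Pi.single ν 1, ν))⁻¹ : (Matrix.specialUnitaryGroup (Fin 2) ℂ)) : Matrix (Fin 2) (Fin 2) ℂ)))‖) 2 (angle (∑ ν ∈ Finset.univ.erase a.1.2,
            (vecQuat (((z.1 (Site.shift a.1.1 a.1.2, ν) * (z.1 (Site.shift a.1.1 ν, a.1.2))⁻¹ * (z.1 (a.1.1, ν))⁻¹)⁻¹ : (Matrix.specialUnitaryGroup (Fin 2) ℂ)) : Matrix (Fin 2) (Fin 2) ℂ) +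
              vecQuat ((((z.1 (Site.shift (a.1.1 - Pi.single ν 1) a.1.2, ν))⁻¹ * (z.1 (a.1.1 - Pi.single ν 1, a.1.2))⁻¹ *
                z.1 (a.1.1 - Pi.single ν 1, ν))⁻¹ : (Matrix.specialUnitaryGroup (Fin 2) ℂ)) : Matrix (Fin 2) (Fin 2) ℂ))) (vecQuat ((z.1 a.1 : (Matrix.specialUnitaryGroup (Fin 2) ℂ)) : Matrix (Fin 2) (Fin 2) ℂ)))))) + ∑ i, z.2 i ^ 2 / 2)
            ((((volume : Measure ((Edge d L × Fin 3) → ℝ)).withDensity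
                  fun p => ENNReal.ofReal (Real.exp (-(∑ i, p i ^ 2 / 2)))) Set.univ)⁻¹ •
              (volume : Measure ((Edge d L × Fin 3) → ℝ)).withDensity
                fun p => ENNReal.ofReal (Real.exp (-(∑ i, p i ^ 2 / 2)))))
          F)
        ((Measure.pi fun _ : Edge d L => haarProbability (Matrix.specialUnitaryGroup (Fin 2) ℂ)).withDensity
          fun U => ENNReal.ofReal (Real.exp (-S U))) := by
  obtain ⟨F, hF, hJ, hpos, hJm⟩ := exists_measurableEquiv_su2WilsonFlowLOSubstep χ hχ μ b hε
  haveI := isNegInvariant_volume_pi (Λ := Edge d L × Fin 3)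
  refine ⟨F, hF, ?_⟩
  exact gauge_fthmc_leapfrog_config_exact
    (μ := Measure.pi fun _ : Edge d L => haarProbability (Matrix.specialUnitaryGroup (Fin 2) ℂ))
    (ν := (volume : Measure ((Edge d L × Fin 3) → ℝ))) (F := F)
    (e := fun p : (Edge d L × Fin 3) → ℝ => fun ℓ : Edge d L => gaussUnit (toLp 2
          ![Real.cos (c * Real.sqrt (p (ℓ, 0) ^ 2 + p (ℓ, 1) ^ 2 + p (ℓ, 2) ^ 2)),
            c * Real.sinc (c * Real.sqrt (p (ℓ, 0) ^ 2 + p (ℓ, 1) ^ 2 + p (ℓ, 2) ^ 2)) * p (ℓ, 0),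
            c * Real.sinc (c * Real.sqrt (p (ℓ, 0) ^ 2 + p (ℓ, 1) ^ 2 + p (ℓ, 2) ^ 2)) * p (ℓ, 1),
            c * Real.sinc (c * Real.sqrt (p (ℓ, 0) ^ 2 + p (ℓ, 1) ^ 2 + p (ℓ, 2) ^ 2)) * p (ℓ, 2)]))
    (g := g) (S := S) (T := fun p : (Edge d L × Fin 3) → ℝ => ∑ i, p i ^ 2 / 2)
    hpos hJm hJ (fun p => su2Drift_neg c p) (measurable_su2Drift c) hg n hS
    measurable_piGaussianKinetic piGaussianWeight_univ_ne_zero_ne_top.1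
    piGaussianWeight_univ_ne_zero_ne_top.2

/-- **… and satisfies detailed balance** with respect to `e^{−S} · ⊗_e haarProbability SU(2)`. -/
theorem su2_fthmc_leapfrog_gaussian_isReversible_wilsonFlowLOSubstep
    (hχ : ∀ (x : Site d L) (i : Fin d), χ (x.shift i) ≠ χ x) (μ : Fin d) (b : X) {ε : ℝ}
    (hε : |ε| * (2 * ((d - 1 : ℕ) : ℝ)) < 1)
    {S : GaugeConfig d L (Matrix.specialUnitaryGroup (Fin 2) ℂ) → ℝ} (hS : Measurable S) (c : ℝ)
    {g : GaugeConfig d L (Matrix.specialUnitaryGroup (Fin 2) ℂ) → ((Edge d L × Fin 3) → ℝ)} (hg : Measurable g) (n : ℕ) :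
    ∃ F : GaugeConfig d L (Matrix.specialUnitaryGroup (Fin 2) ℂ) ≃ᵐ GaugeConfig d L (Matrix.specialUnitaryGroup (Fin 2) ℂ),
      (⇑F = fun (V : GaugeConfig d L (Matrix.specialUnitaryGroup (Fin 2) ℂ)) (e : Edge d L) =>
        if e.2 = μ ∧ χ e.1 = b then
          gaussUnit (geodesicKick ε (∑ ν ∈ Finset.univ.erase e.2,
            (vecQuat (((V (Site.shift e.1 e.2, ν) * (V (Site.shift e.1 ν, e.2))⁻¹ * (V (e.1, ν))⁻¹)⁻¹ : (Matrix.specialUnitaryGroup (Fin 2) ℂ)) : Matrix (Fin 2) (Fin 2) ℂ) +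
              vecQuat ((((V (Site.shift (e.1 - Pi.single ν 1) e.2, ν))⁻¹ * (V (e.1 - Pi.single ν 1, e.2))⁻¹ *
                V (e.1 - Pi.single ν 1, ν))⁻¹ : (Matrix.specialUnitaryGroup (Fin 2) ℂ)) : Matrix (Fin 2) (Fin 2) ℂ)))
            (vecQuat ((V e : (Matrix.specialUnitaryGroup (Fin 2) ℂ)) : Matrix (Fin 2) (Fin 2) ℂ)))
        else V e) ∧
      IsReversible
        (conjKernel
          (refreshUpdate
            (involMH
              (⇑((flip : Equiv.Perm (GaugeConfig d L (Matrix.specialUnitaryGroup (Fin 2) ℂ) × ((Edge d L × Fin 3) → ℝ))) *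
                  leapfrog (mulDrift fun p : (Edge d L × Fin 3) → ℝ =>
                    fun ℓ : Edge d L => gaussUnit (toLp 2
          ![Real.cos (c * Real.sqrt (p (ℓ, 0) ^ 2 + p (ℓ, 1) ^ 2 + p (ℓ, 2) ^ 2)),
            c * Real.sinc (c * Real.sqrt (p (ℓ, 0) ^ 2 + p (ℓ, 1) ^ 2 + p (ℓ, 2) ^ 2)) * p (ℓ, 0),
            c * Real.sinc (c * Real.sqrt (p (ℓ, 0) ^ 2 + p (ℓ, 1) ^ 2 + p (ℓ, 2) ^ 2)) * p (ℓ, 1),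
            c * Real.sinc (c * Real.sqrt (p (ℓ, 0) ^ 2 + p (ℓ, 1) ^ 2 + p (ℓ, 2) ^ 2)) * p (ℓ, 2)])) g ^ n))
              (measurable_flip_leapfrog_pow (measurable_mulDrift (measurable_su2Drift c)) hg n)
              fun z : GaugeConfig d L (Matrix.specialUnitaryGroup (Fin 2) ℂ) × ((Edge d L × Fin 3) → ℝ) =>
                (S (F z.1) - Real.log (∏ a : {e : Edge d L // e.2 = μ ∧ χ e.1 = b},
          (if Real.sin (angle (∑ ν ∈ Finset.univ.erase a.1.2,
            (vecQuat (((z.1 (Site.shift a.1.1 a.1.2, ν) * (z.1 (Site.shift a.1.1 ν, a.1.2))⁻¹ * (z.1 (a.1.1, ν))⁻¹)⁻¹ : (Matrix.specialUnitaryGroup (Fin 2) ℂ)) : Matrix (Fin 2) (Fin 2) ℂ) +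
              vecQuat ((((z.1 (Site.shift (a.1.1 - Pi.single ν 1) a.1.2, ν))⁻¹ * (z.1 (a.1.1 - Pi.single ν 1, a.1.2))⁻¹ *
                z.1 (a.1.1 - Pi.single ν 1, ν))⁻¹ : (Matrix.specialUnitaryGroup (Fin 2) ℂ)) : Matrix (Fin 2) (Fin 2) ℂ))) (vecQuat ((z.1 a.1 : (Matrix.specialUnitaryGroup (Fin 2) ℂ)) : Matrix (Fin 2) (Fin 2) ℂ))) = 0 then
            (1 - ε * ‖(∑ ν ∈ Finset.univ.erase a.1.2,
            (vecQuat (((z.1 (Site.shift a.1.1 a.1.2, ν) * (z.1 (Site.shift a.1.1 ν, a.1.2))⁻¹ * (z.1 (a.1.1, ν))⁻¹)⁻¹ : (Matrix.specialUnitaryGroup (Fin 2) ℂ)) : Matrix (Fin 2) (Fin 2) ℂ) +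
              vecQuat ((((z.1 (Site.shift (a.1.1 - Pi.single ν 1) a.1.2, ν))⁻¹ * (z.1 (a.1.1 - Pi.single ν 1, a.1.2))⁻¹ *
                z.1 (a.1.1 - Pi.single ν 1, ν))⁻¹ : (Matrix.specialUnitaryGroup (Fin 2) ℂ)) : Matrix (Fin 2) (Fin 2) ℂ)))‖ * Real.cos (angle (∑ ν ∈ Finset.univ.erase a.1.2,
            (vecQuat (((z.1 (Site.shift a.1.1 a.1.2, ν) * (z.1 (Site.shift a.1.1 ν, a.1.2))⁻¹ * (z.1 (a.1.1, ν))⁻¹)⁻¹ : (Matrix.specialUnitaryGroup (Fin 2) ℂ)) : Matrix (Fin 2) (Fin 2) ℂ) +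
              vecQuat ((((z.1 (Site.shift (a.1.1 - Pi.single ν 1) a.1.2, ν))⁻¹ * (z.1 (a.1.1 - Pi.single ν 1, a.1.2))⁻¹ *
                z.1 (a.1.1 - Pi.single ν 1, ν))⁻¹ : (Matrix.specialUnitaryGroup (Fin 2) ℂ)) : Matrix (Fin 2) (Fin 2) ℂ))) (vecQuat ((z.1 a.1 : (Matrix.specialUnitaryGroup (Fin 2) ℂ)) : Matrix (Fin 2) (Fin 2) ℂ)))) ^ 3
          else kickJac (ε * ‖(∑ ν ∈ Finset.univ.erase a.1.2,
            (vecQuat (((z.1 (Site.shift a.1.1 a.1.2, ν) * (z.1 (Site.shift a.1.1 ν, a.1.2))⁻¹ * (z.1 (a.1.1, ν))⁻¹)⁻¹ : (Matrix.specialUnitaryGroup (Fin 2) ℂ)) : Matrix (Fin 2) (Fin 2) ℂ) +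
              vecQuat ((((z.1 (Site.shift (a.1.1 - Pi.single ν 1) a.1.2, ν))⁻¹ * (z.1 (a.1.1 - Pi.single ν 1, a.1.2))⁻¹ *
                z.1 (a.1.1 - Pi.single ν 1, ν))⁻¹ : (Matrix.specialUnitaryGroup (Fin 2) ℂ)) : Matrix (Fin 2) (Fin 2) ℂ)))‖) 2 (angle (∑ ν ∈ Finset.univ.erase a.1.2,
            (vecQuat (((z.1 (Site.shift a.1.1 a.1.2, ν) * (z.1 (Site.shift a.1.1 ν, a.1.2))⁻¹ * (z.1 (a.1.1, ν))⁻¹)⁻¹ : (Matrix.specialUnitaryGroup (Fin 2) ℂ)) : Matrix (Fin 2) (Fin 2) ℂ) +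
              vecQuat ((((z.1 (Site.shift (a.1.1 - Pi.single ν 1) a.1.2, ν))⁻¹ * (z.1 (a.1.1 - Pi.single ν 1, a.1.2))⁻¹ *
                z.1 (a.1.1 - Pi.single ν 1, ν))⁻¹ : (Matrix.specialUnitaryGroup (Fin 2) ℂ)) : Matrix (Fin 2) (Fin 2) ℂ))) (vecQuat ((z.1 a.1 : (Matrix.specialUnitaryGroup (Fin 2) ℂ)) : Matrix (Fin 2) (Fin 2) ℂ)))))) + ∑ i, z.2 i ^ 2 / 2)
            ((((volume : Measure ((Edge d L × Fin 3) → ℝ)).withDensity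
                  fun p => ENNReal.ofReal (Real.exp (-(∑ i, p i ^ 2 / 2)))) Set.univ)⁻¹ •
              (volume : Measure ((Edge d L × Fin 3) → ℝ)).withDensity
                fun p => ENNReal.ofReal (Real.exp (-(∑ i, p i ^ 2 / 2)))))
          F)
        ((Measure.pi fun _ : Edge d L => haarProbability (Matrix.specialUnitaryGroup (Fin 2) ℂ)).withDensity
          fun U => ENNReal.ofReal (Real.exp (-S U))) := by
  obtain ⟨F, hF, hJ, hpos, hJm⟩ := exists_measurableEquiv_su2WilsonFlowLOSubstep χ hχ μ b hε
  haveI := isNegInvariant_volume_pi (Λ := Edge d L × Fin 3)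
  refine ⟨F, hF, ?_⟩
  exact gauge_fthmc_leapfrog_config_isReversible
    (μ := Measure.pi fun _ : Edge d L => haarProbability (Matrix.specialUnitaryGroup (Fin 2) ℂ))
    (ν := (volume : Measure ((Edge d L × Fin 3) → ℝ))) (F := F)
    (e := fun p : (Edge d L × Fin 3) → ℝ => fun ℓ : Edge d L => gaussUnit (toLp 2
          ![Real.cos (c * Real.sqrt (p (ℓ, 0) ^ 2 + p (ℓ, 1) ^ 2 + p (ℓ, 2) ^ 2)),
            c * Real.sinc (c * Real.sqrt (p (ℓ, 0) ^ 2 + p (ℓ, 1) ^ 2 + p (ℓ, 2) ^ 2)) * p (ℓ, 0),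
            c * Real.sinc (c * Real.sqrt (p (ℓ, 0) ^ 2 + p (ℓ, 1) ^ 2 + p (ℓ, 2) ^ 2)) * p (ℓ, 1),
            c * Real.sinc (c * Real.sqrt (p (ℓ, 0) ^ 2 + p (ℓ, 1) ^ 2 + p (ℓ, 2) ^ 2)) * p (ℓ, 2)]))
    (g := g) (S := S) (T := fun p : (Edge d L × Fin 3) → ℝ => ∑ i, p i ^ 2 / 2)
    hpos hJm hJ (fun p => su2Drift_neg c p) (measurable_su2Drift c) hg n hS
    measurable_piGaussianKinetic

end Member

end Summit.Ventures.LatticeQCDFlow.Exactness
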